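import Mathlib

/-!
# Crux `MonotoneSuffices` (stmt-PneNP-18026), the ROOM theorem — part 4b:
# the parameters of the guess-and-verify detector (integer facts, null and planted sides)

With `k = ⌈n^{1/2-δ}⌉`, `L = ⌊log₂ n⌋`, the detector guesses `t`-sets with
`Q = 800 n (L+1)² / k² + 1`, `t = ⌊log₂ Q⌋ + 1` (so `Q < 2^t ≤ 2Q`, i.e. `2^t ≈ n^{2δ} log² n`) and uses
the threshold `θ = (n-t)/2^t + k/4 + 1` on the number of common neighbours. From the base inequalities of
part 4a (`2048 ≤ n`, `3200 (L+1)² + 20 ≤ k`, `6k ≤ n`, `k² ≤ 4n`, `n^{1-2δ} ≤ k²`,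
`18 + 2 log₂(L+1) ≤ ε log₂ n`) this file and the next derive, for one `n`, everything the error and size
analysis needs. Here: the integer facts (`natFacts`: `Q < 2^t ≤ 2Q`, `8 ≤ t ≤ 3L+13`, `8t ≤ k`,
`2^t k + k ≤ n`); with `μ = (n-t) 2^{-t}`: `0 < μ ≤ θ ≤ 3μ` and `C(n,t) · exp(-(θ/μ-1)² μ/4) ≤ e^{-(L+1)}`
(`nullSide`); with `μ₁ = (n-k) 2^{-t}`, `τ = θ-(k-t)-1`: `0 < μ₁`, `|τ| ≤ μ₁` and
`exp(-(1-τ/μ₁)² μ₁/4) ≤ e^{-(L+1)}` (`plantedSide`). Elementary arithmetic only.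
-/

set_option linter.dupNamespace false -- `Summit.PneNP.PneNP.…`: summit = sub-problem name (D-0017 single-conjunct layout)

namespace Summit.PneNP.PneNP.Theorems.MonotoneSuffices.Room

open Real Finset

/-! ### Natural-number bookkeeping for `Q`, `t`, `k` -/

/-- The integer facts: `Q < 2^t ≤ 2Q`, `Q k² ≤ 800 n (L+1)² + k² < Q k² + k²`, `8 ≤ t ≤ 3L + 13`,
`8t ≤ k`, `2^t k + k ≤ n`, `2^L ≤ n < 2^{L+1}`, `11 ≤ L`. [folklore] -/
theorem natFacts {n k L Q t : ℕ} (hL : L = Nat.log 2 n) (hQ : Q = 800 * n * (L + 1) ^ 2 / k ^ 2 + 1)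
    (ht : t = Nat.log 2 Q + 1) (hn : 2048 ≤ n) (hkBig : 3200 * (L + 1) ^ 2 + 20 ≤ k) (h6k : 6 * k ≤ n)
    (hk2 : k ^ 2 ≤ 4 * n) :
    Q < 2 ^ t ∧ 2 ^ t ≤ 2 * Q ∧ Q * k ^ 2 ≤ 800 * n * (L + 1) ^ 2 + k ^ 2 ∧
      800 * n * (L + 1) ^ 2 < Q * k ^ 2 ∧ 8 ≤ t ∧ t ≤ 3 * L + 13 ∧ 8 * t ≤ k ∧ 2 ^ t * k + k ≤ n ∧
      2 ^ L ≤ n ∧ n < 2 ^ (L + 1) ∧ 11 ≤ L := by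
  have hn0 : n ≠ 0 := by omega
  have hk0 : 0 < k := by nlinarith
  have hk20 : 0 < k ^ 2 := by positivity
  have hQ0 : Q ≠ 0 := by rw [hQ]; exact Nat.succ_ne_zero _
  -- `Q < 2^t ≤ 2Q`
  have h1 : Q < 2 ^ t := by rw [ht]; exact Nat.lt_pow_succ_log_self (by norm_num) Q
  have h2 : 2 ^ t ≤ 2 * Q := by
    rw [ht, pow_succ]
    have := Nat.pow_log_le_self 2 hQ0
    omega
  -- `Q k² ≤ 800 n (L+1)² + k²` and `800 n (L+1)² < Q k²`
  have h3 : Q * k ^ 2 ≤ 800 * n * (L + 1) ^ 2 + k ^ 2 := by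
    rw [hQ, add_mul, one_mul]
    exact Nat.add_le_add_right (Nat.div_mul_le_self _ _) _
  have h4 : 800 * n * (L + 1) ^ 2 < Q * k ^ 2 := by
    rw [hQ, add_mul, one_mul]
    exact Nat.lt_div_mul_add hk20
  -- `2^L ≤ n < 2^{L+1}`
  have hLn : 2 ^ L ≤ n := by rw [hL]; exact Nat.pow_log_le_self 2 hn0
  have hnL : n < 2 ^ (L + 1) := by rw [hL]; exact Nat.lt_pow_succ_log_self (by norm_num) n
  have hL11 : 11 ≤ L := by
    rw [hL]
    exact Nat.le_log_of_pow_le (by norm_num) (by norm_num; omega)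
  -- `8 ≤ t`: `Q k² > 800 n ≥ 200 k²`, so `Q > 200`, so `2^t > 200 > 2^7`
  have h5 : 8 ≤ t := by
    have hQ200 : 200 < Q := by
      by_contra hc
      have hc' : Q ≤ 200 := by omega
      have hA : Q * k ^ 2 ≤ 200 * k ^ 2 := Nat.mul_le_mul_right _ hc'
      have hB : 800 * n ≤ 800 * n * (L + 1) ^ 2 :=
        Nat.le_mul_of_pos_right _ (by positivity)
      omega
    by_contra hc
    have : 2 ^ t ≤ 2 ^ 7 := Nat.pow_le_pow_right (by norm_num) (by omega)
    omega
  -- `t ≤ 3L + 13`: `2^t ≤ 2Q ≤ 1600 n (L+1)² + 2 ≤ 1600 n³ + 2 < 2^{11} n³ ≤ 2^{11} (2^{L+1})³`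
  have h6 : t ≤ 3 * L + 13 := by
    have hL1 : L + 1 ≤ 2 ^ L := Nat.lt_two_pow_self
    have hL2 : (L + 1) ^ 2 ≤ n ^ 2 := Nat.pow_le_pow_left (hL1.trans hLn) 2
    have hQ' : Q ≤ 800 * n * (L + 1) ^ 2 + 1 := by
      rw [hQ]; exact Nat.add_le_add_right (Nat.div_le_self _ _) _
    have hC : 800 * n * (L + 1) ^ 2 ≤ 800 * n * n ^ 2 := Nat.mul_le_mul_left _ hL2
    have hn3 : 1 ≤ n ^ 3 := Nat.one_le_pow _ _ (Nat.pos_of_ne_zero hn0)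
    have hD : 2 * (800 * n * n ^ 2 + 1) < 2 ^ 11 * n ^ 3 := by ring_nf; omega
    have hE : n ^ 3 ≤ (2 ^ (L + 1)) ^ 3 := Nat.pow_le_pow_left hnL.le 3
    have hlt : 2 ^ t < 2 ^ (3 * L + 14) := by
      calc 2 ^ t ≤ 2 * Q := h2
        _ ≤ 2 * (800 * n * (L + 1) ^ 2 + 1) := Nat.mul_le_mul_left 2 hQ'
        _ ≤ 2 * (800 * n * n ^ 2 + 1) := by omega
        _ < 2 ^ 11 * n ^ 3 := hD
        _ ≤ 2 ^ 11 * (2 ^ (L + 1)) ^ 3 := Nat.mul_le_mul_left _ hE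
        _ = 2 ^ (3 * L + 14) := by ring
    have := (Nat.pow_lt_pow_iff_right (by norm_num)).1 hlt
    omega
  -- `8t ≤ k`
  have h7 : 8 * t ≤ k := by nlinarith
  -- `2^t k + k ≤ n`: multiply by `k`
  have h8 : 2 ^ t * k + k ≤ n := by
    have hmul : (2 ^ t * k + k) * k ≤ n * k := by
      have : 2 ^ t * k ^ 2 ≤ 2 * (800 * n * (L + 1) ^ 2 + k ^ 2) := by
        calc 2 ^ t * k ^ 2 ≤ 2 * Q * k ^ 2 := Nat.mul_le_mul_right _ h2
          _ = 2 * (Q * k ^ 2) := by ring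
          _ ≤ 2 * (800 * n * (L + 1) ^ 2 + k ^ 2) := Nat.mul_le_mul_left _ h3
      nlinarith
    exact Nat.le_of_mul_le_mul_right hmul hk0
  exact ⟨h1, h2, h3, h4, h5, h6, h7, h8, hLn, hnL, hL11⟩

/-! ### Real bookkeeping -/

/-- `(a / b : ℕ)` is within one of `a / b` in `ℝ`. [folklore] -/
theorem natDiv_bounds (a b : ℕ) (hb : 0 < b) :
    (a : ℝ) / b - 1 < ((a / b : ℕ) : ℝ) ∧ ((a / b : ℕ) : ℝ) ≤ (a : ℝ) / b := by
  refine ⟨?_, Nat.cast_div_le⟩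
  have h := Nat.lt_div_mul_add (a := a) hb
  have hb' : (0 : ℝ) < b := by exact_mod_cast hb
  have hR : (a : ℝ) < ((a / b : ℕ) : ℝ) * b + b := by exact_mod_cast h
  rw [div_sub_one hb'.ne', div_lt_iff₀ hb']
  linarith

/-- The threshold `θ = (n-t)/2^t + k/4 + 1` is within one of `(n-t) 2^{-t} + k/4`. [folklore] -/
theorem theta_bounds {n k t θ : ℕ} (hθ : θ = (n - t) / 2 ^ t + k / 4 + 1) :
    ((n - t : ℕ) : ℝ) * (2 : ℝ)⁻¹ ^ t + k / 4 - 1 < θ ∧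
      (θ : ℝ) ≤ ((n - t : ℕ) : ℝ) * (2 : ℝ)⁻¹ ^ t + k / 4 + 1 := by
  have hA := natDiv_bounds (n - t) (2 ^ t) (by positivity)
  have hB := natDiv_bounds k 4 (by norm_num)
  have hcast : (θ : ℝ) = (((n - t) / 2 ^ t : ℕ) : ℝ) + ((k / 4 : ℕ) : ℝ) + 1 := by
    rw [hθ]; push_cast; ring
  have hμ : ((n - t : ℕ) : ℝ) * (2 : ℝ)⁻¹ ^ t = ((n - t : ℕ) : ℝ) / ((2 ^ t : ℕ) : ℝ) := by
    rw [inv_pow, div_eq_mul_inv]; push_cast; ring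
  rw [hμ, hcast]
  constructor
  · have h4 : ((4 : ℕ) : ℝ) = 4 := by norm_num
    rw [h4] at hB
    linarith [hA.1, hB.1]
  · have h4 : ((4 : ℕ) : ℝ) = 4 := by norm_num
    rw [h4] at hB
    linarith [hA.2, hB.2]

/-- `800 n (L+1)² < 2^t k²` over `ℝ`. [folklore] -/
theorem key_real {n k L Q t : ℕ} (hQt : Q < 2 ^ t) (hQk' : 800 * n * (L + 1) ^ 2 < Q * k ^ 2) :
    (800 * n * ((L : ℝ) + 1) ^ 2 : ℝ) < 2 ^ t * (k : ℝ) ^ 2 := by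
  have h1 : ((800 * n * (L + 1) ^ 2 : ℕ) : ℝ) < ((Q * k ^ 2 : ℕ) : ℝ) := by exact_mod_cast hQk'
  have h2 : ((Q * k ^ 2 : ℕ) : ℝ) ≤ ((2 ^ t * k ^ 2 : ℕ) : ℝ) := by
    exact_mod_cast Nat.mul_le_mul_right _ hQt.le
  push_cast at h1 h2
  linarith

/-- **Null side.** With `μ = (n-t) 2^{-t}`: `0 < μ ≤ θ ≤ 3μ` and
`C(n,t) · exp(-(θ/μ - 1)² μ / 4) ≤ e^{-(L+1)}`. [folklore] -/
theorem nullSide {n k L Q t θ : ℕ} (hθ : θ = (n - t) / 2 ^ t + k / 4 + 1)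
    (hQt : Q < 2 ^ t) (hQk' : 800 * n * (L + 1) ^ 2 < Q * k ^ 2) (ht3L : t ≤ 3 * L + 13)
    (hE3 : 2 ^ t * k + k ≤ n) (hnL : n < 2 ^ (L + 1)) (hL11 : 11 ≤ L) (hk20 : 20 ≤ k) (htk : t ≤ k) :
    0 < ((n - t : ℕ) : ℝ) * (2 : ℝ)⁻¹ ^ t ∧ ((n - t : ℕ) : ℝ) * (2 : ℝ)⁻¹ ^ t ≤ θ ∧
      (θ : ℝ) ≤ 3 * (((n - t : ℕ) : ℝ) * (2 : ℝ)⁻¹ ^ t) ∧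
      (n.choose t : ℝ) * Real.exp (-(((θ : ℝ) / (((n - t : ℕ) : ℝ) * (2 : ℝ)⁻¹ ^ t) - 1) ^ 2 *
        (((n - t : ℕ) : ℝ) * (2 : ℝ)⁻¹ ^ t)) / 4) ≤ Real.exp (-((L : ℝ) + 1)) := by
  have hkn : k < n := by
    have : k ≤ 2 ^ t * k := Nat.le_mul_of_pos_left k (by positivity)
    omega
  have htn : t ≤ n := by omega
  obtain ⟨hθlo, hθhi⟩ := theta_bounds hθ
  set μ : ℝ := ((n - t : ℕ) : ℝ) * (2 : ℝ)⁻¹ ^ t with hμdef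
  have h2t : (0 : ℝ) < 2 ^ t := by positivity
  have hμeq : μ = ((n : ℝ) - t) / 2 ^ t := by
    rw [hμdef, inv_pow, Nat.cast_sub htn, div_eq_mul_inv]
  have hnt_pos : (0 : ℝ) < (n : ℝ) - t := by
    have : (t : ℝ) < n := by exact_mod_cast lt_of_le_of_lt htk hkn
    linarith
  have hμpos : 0 < μ := by rw [hμeq]; exact div_pos hnt_pos h2t
  -- `k ≤ μ` (from `2^t k ≤ n - k ≤ n - t`)
  have hkμ : (k : ℝ) ≤ μ := by
    rw [hμeq, le_div_iff₀ h2t]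
    have h : ((2 ^ t * k + k : ℕ) : ℝ) ≤ n := by exact_mod_cast hE3
    push_cast at h
    have htk' : (t : ℝ) ≤ k := by exact_mod_cast htk
    linarith
  have hk20' : (20 : ℝ) ≤ k := by exact_mod_cast hk20
  have ha : μ ≤ θ := by linarith
  have hb : (θ : ℝ) ≤ 3 * μ := by linarith
  -- the exponent: `32 (L+1)² ≤ (θ/μ - 1)² μ = (θ - μ)²/μ`
  have hη : ((θ : ℝ) / μ - 1) ^ 2 * μ = ((θ : ℝ) - μ) ^ 2 / μ := by
    field_simp
  have hQR := key_real hQt hQk'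
  have hμle : μ ≤ n / 2 ^ t := by
    rw [hμeq]
    exact div_le_div_of_nonneg_right (by linarith [(Nat.cast_nonneg t : (0 : ℝ) ≤ t)]) h2t.le
  have h32 : 32 * ((L : ℝ) + 1) ^ 2 * μ ≤ ((θ : ℝ) - μ) ^ 2 := by
    have hθμ : (k : ℝ) / 5 ≤ (θ : ℝ) - μ := by linarith
    have hsq : ((k : ℝ) / 5) ^ 2 ≤ ((θ : ℝ) - μ) ^ 2 := pow_le_pow_left₀ (by positivity) hθμ 2
    have h3 : 32 * ((L : ℝ) + 1) ^ 2 * μ ≤ 32 * ((L : ℝ) + 1) ^ 2 * (n / 2 ^ t) :=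
      mul_le_mul_of_nonneg_left hμle (by positivity)
    have h4 : 32 * ((L : ℝ) + 1) ^ 2 * (n / 2 ^ t) ≤ (k : ℝ) ^ 2 / 25 := by
      rw [show 32 * ((L : ℝ) + 1) ^ 2 * (n / 2 ^ t) = (800 * n * ((L : ℝ) + 1) ^ 2) / 25 / 2 ^ t by ring,
        div_le_iff₀ h2t]
      linarith
    calc 32 * ((L : ℝ) + 1) ^ 2 * μ ≤ (k : ℝ) ^ 2 / 25 := h3.trans h4
      _ = ((k : ℝ) / 5) ^ 2 := by ring
      _ ≤ _ := hsq
  have hημ : 32 * ((L : ℝ) + 1) ^ 2 ≤ ((θ : ℝ) / μ - 1) ^ 2 * μ := by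
    rw [hη, le_div_iff₀ hμpos]; exact h32
  -- `C(n,t) ≤ n^t ≤ 2^{(L+1)t} ≤ e^{(L+1)t}`
  have hchoose : (n.choose t : ℝ) ≤ Real.exp (((L : ℝ) + 1) * t) := by
    have h1 : n.choose t ≤ n ^ t := Nat.choose_le_pow n t
    have h2 : n ^ t ≤ (2 ^ (L + 1)) ^ t := Nat.pow_le_pow_left hnL.le t
    have h3 : ((n.choose t : ℕ) : ℝ) ≤ (((2 ^ (L + 1)) ^ t : ℕ) : ℝ) := by exact_mod_cast h1.trans h2
    refine h3.trans ?_
    -- `2^m ≤ e^m` (cf. `Literature.Barriers.PneNP.Zoom.two_pow_le_exp`, not imported here)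
    have h4 : (2 : ℝ) ^ ((L + 1) * t) ≤ Real.exp (((L + 1) * t : ℕ) : ℝ) := by
      calc (2 : ℝ) ^ ((L + 1) * t) ≤ (Real.exp 1) ^ ((L + 1) * t) :=
            pow_le_pow_left₀ (by norm_num) (by linarith [Real.add_one_le_exp (1 : ℝ)]) _
        _ = Real.exp (((L + 1) * t : ℕ) : ℝ) := by rw [← Real.exp_nat_mul, mul_one]
    rw [← pow_mul]
    push_cast at h4 ⊢
    exact h4
  have hexp : Real.exp (-(((θ : ℝ) / μ - 1) ^ 2 * μ) / 4) ≤ Real.exp (-(8 * ((L : ℝ) + 1) ^ 2)) :=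
    Real.exp_le_exp.2 (by linarith)
  have ht' : (t : ℝ) ≤ 3 * L + 13 := by exact_mod_cast ht3L
  have hL' : (11 : ℝ) ≤ L := by exact_mod_cast hL11
  refine ⟨hμpos, ha, hb, ?_⟩
  calc (n.choose t : ℝ) * Real.exp (-(((θ : ℝ) / μ - 1) ^ 2 * μ) / 4)
      ≤ Real.exp (((L : ℝ) + 1) * t) * Real.exp (-(8 * ((L : ℝ) + 1) ^ 2)) :=
        mul_le_mul hchoose hexp (Real.exp_pos _).le (Real.exp_pos _).le
    _ = Real.exp (((L : ℝ) + 1) * t + -(8 * ((L : ℝ) + 1) ^ 2)) := (Real.exp_add _ _).symm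
    _ ≤ Real.exp (-((L : ℝ) + 1)) := Real.exp_le_exp.2 (by
        nlinarith [mul_nonneg (by positivity : (0 : ℝ) ≤ (L : ℝ) + 1)
          (by linarith : (0 : ℝ) ≤ 8 * ((L : ℝ) + 1) - t - 1)])

/-- **Planted side.** With `μ₁ = (n-k) 2^{-t}`, `τ = θ - (k-t) - 1`: `0 < μ₁`, `|τ| ≤ μ₁` and
`exp(-(1 - τ/μ₁)² μ₁ / 4) ≤ e^{-(L+1)}`. [folklore] -/
theorem plantedSide {n k L Q t θ : ℕ} (hθ : θ = (n - t) / 2 ^ t + k / 4 + 1)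
    (hQt : Q < 2 ^ t) (hQk' : 800 * n * (L + 1) ^ 2 < Q * k ^ 2) (ht8 : 8 ≤ t) (h8t : 8 * t ≤ k)
    (hE3 : 2 ^ t * k + k ≤ n) (hk20 : 20 ≤ k) :
    0 < ((n - k : ℕ) : ℝ) * (2 : ℝ)⁻¹ ^ t ∧
      -(((n - k : ℕ) : ℝ) * (2 : ℝ)⁻¹ ^ t) ≤ (θ : ℝ) - ((k - t : ℕ) : ℝ) - 1 ∧
      (θ : ℝ) - ((k - t : ℕ) : ℝ) - 1 ≤ ((n - k : ℕ) : ℝ) * (2 : ℝ)⁻¹ ^ t ∧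
      Real.exp (-((1 - ((θ : ℝ) - ((k - t : ℕ) : ℝ) - 1) / (((n - k : ℕ) : ℝ) * (2 : ℝ)⁻¹ ^ t)) ^ 2 *
        (((n - k : ℕ) : ℝ) * (2 : ℝ)⁻¹ ^ t)) / 4) ≤ Real.exp (-((L : ℝ) + 1)) := by
  have htk : t ≤ k := by omega
  have hkn : k < n := by
    have : k ≤ 2 ^ t * k := Nat.le_mul_of_pos_left k (by positivity)
    omega
  have htn : t ≤ n := by omega
  obtain ⟨hθlo, hθhi⟩ := theta_bounds hθ
  set μ₁ : ℝ := ((n - k : ℕ) : ℝ) * (2 : ℝ)⁻¹ ^ t with hμ₁def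
  set τ : ℝ := (θ : ℝ) - ((k - t : ℕ) : ℝ) - 1 with hτdef
  have h2t : (0 : ℝ) < 2 ^ t := by positivity
  have hμ₁eq : μ₁ = ((n : ℝ) - k) / 2 ^ t := by
    rw [hμ₁def, inv_pow, Nat.cast_sub hkn.le, div_eq_mul_inv]
  have hμeq : ((n - t : ℕ) : ℝ) * (2 : ℝ)⁻¹ ^ t = ((n : ℝ) - t) / 2 ^ t := by
    rw [inv_pow, Nat.cast_sub htn, div_eq_mul_inv]
  rw [hμeq] at hθlo hθhi
  have hτeq : τ = (θ : ℝ) - k + t - 1 := by rw [hτdef, Nat.cast_sub htk]; ring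
  have hnk_pos : (0 : ℝ) < (n : ℝ) - k := by
    have : (k : ℝ) < n := by exact_mod_cast hkn
    linarith
  have hμ₁pos : 0 < μ₁ := by rw [hμ₁eq]; exact div_pos hnk_pos h2t
  have h2t8 : (256 : ℝ) ≤ 2 ^ t := by
    have : (2 : ℝ) ^ 8 ≤ 2 ^ t := pow_le_pow_right₀ (by norm_num) ht8
    norm_num at this
    exact this
  have hk' : (20 : ℝ) ≤ k := by exact_mod_cast hk20
  have h8t' : 8 * (t : ℝ) ≤ k := by exact_mod_cast h8t
  have htk' : (t : ℝ) ≤ k := by exact_mod_cast htk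
  have ht0 : (0 : ℝ) ≤ t := Nat.cast_nonneg t
  -- `k ≤ μ₁` (from `2^t k ≤ n - k`)
  have hkμ₁ : (k : ℝ) ≤ μ₁ := by
    rw [hμ₁eq, le_div_iff₀ h2t]
    have h : ((2 ^ t * k + k : ℕ) : ℝ) ≤ n := by exact_mod_cast hE3
    push_cast at h
    linarith
  -- `(n-t)/2^t - (n-k)/2^t = (k-t)/2^t ≤ k/256`
  have hdiff : ((n : ℝ) - t) / 2 ^ t - ((n : ℝ) - k) / 2 ^ t ≤ k / 256 := by
    rw [← sub_div, div_le_div_iff₀ h2t (by norm_num)]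
    nlinarith [mul_le_mul h2t8 (show (k : ℝ) - t ≤ k by linarith) (by linarith) (by positivity)]
  -- the gap `μ₁ - τ ≥ k/2`
  have hgap : (k : ℝ) / 2 ≤ μ₁ - τ := by
    rw [hτeq, hμ₁eq]
    linarith
  have hc1 : τ ≤ μ₁ := by linarith
  have hc2 : -μ₁ ≤ τ := by
    have : (0 : ℝ) ≤ ((n : ℝ) - t) / 2 ^ t := div_nonneg (by linarith) h2t.le
    linarith
  -- the exponent: `200 (L+1)² ≤ (1 - τ/μ₁)² μ₁ = (μ₁ - τ)²/μ₁`
  have hη : (1 - τ / μ₁) ^ 2 * μ₁ = (μ₁ - τ) ^ 2 / μ₁ := by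
    field_simp
  have hQR := key_real hQt hQk'
  have hμ₁le : μ₁ ≤ n / 2 ^ t := by
    rw [hμ₁eq]
    exact div_le_div_of_nonneg_right (by linarith [(Nat.cast_nonneg k : (0 : ℝ) ≤ k)]) h2t.le
  have h200 : 200 * ((L : ℝ) + 1) ^ 2 * μ₁ ≤ (μ₁ - τ) ^ 2 := by
    have hsq : ((k : ℝ) / 2) ^ 2 ≤ (μ₁ - τ) ^ 2 := pow_le_pow_left₀ (by positivity) hgap 2
    have h3 : 200 * ((L : ℝ) + 1) ^ 2 * μ₁ ≤ 200 * ((L : ℝ) + 1) ^ 2 * (n / 2 ^ t) :=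
      mul_le_mul_of_nonneg_left hμ₁le (by positivity)
    have h4 : 200 * ((L : ℝ) + 1) ^ 2 * (n / 2 ^ t) ≤ (k : ℝ) ^ 2 / 4 := by
      rw [show 200 * ((L : ℝ) + 1) ^ 2 * (n / 2 ^ t) = (800 * n * ((L : ℝ) + 1) ^ 2) / 4 / 2 ^ t by ring,
        div_le_iff₀ h2t]
      linarith
    calc 200 * ((L : ℝ) + 1) ^ 2 * μ₁ ≤ (k : ℝ) ^ 2 / 4 := h3.trans h4
      _ = ((k : ℝ) / 2) ^ 2 := by ring
      _ ≤ _ := hsq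
  have hημ : 200 * ((L : ℝ) + 1) ^ 2 ≤ (1 - τ / μ₁) ^ 2 * μ₁ := by
    rw [hη, le_div_iff₀ hμ₁pos]; exact h200
  have hL0 : (0 : ℝ) ≤ L := Nat.cast_nonneg L
  refine ⟨hμ₁pos, hc2, hc1, Real.exp_le_exp.2 ?_⟩
  nlinarith

end Summit.PneNP.PneNP.Theorems.MonotoneSuffices.Room

namespace Summit.PneNP.PneNP.Theorems.MonotoneSuffices.Room

/-- Registered sub-goal `room_nullside` of stmt-PneNP-18026 (room theorem, part 4b): the null-side
parameter facts, exported verbatim. [folklore] -/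
theorem room_nullside :
    ∀ {n k L Q t θ : ℕ}, θ = (n - t) / 2 ^ t + k / 4 + 1 → Q < 2 ^ t → 800 * n * (L + 1) ^ 2 < Q * k ^ 2 → t ≤ 3 * L + 13 → 2 ^ t * k + k ≤ n → n < 2 ^ (L + 1) → 11 ≤ L → 20 ≤ k → t ≤ k → 0 < ((n - t : ℕ) : ℝ) * (2 : ℝ)⁻¹ ^ t ∧ ((n - t : ℕ) : ℝ) * (2 : ℝ)⁻¹ ^ t ≤ θ ∧ (θ : ℝ) ≤ 3 * (((n - t : ℕ) : ℝ) * (2 : ℝ)⁻¹ ^ t) ∧ (n.choose t : ℝ) * Real.exp (-(((θ : ℝ) / (((n - t : ℕ) : ℝ) * (2 : ℝ)⁻¹ ^ t) - 1) ^ 2 * (((n - t : ℕ) : ℝ) * (2 : ℝ)⁻¹ ^ t)) / 4) ≤ Real.exp (-((L : ℝ) + 1)) :=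
  fun hθ hQt hQk' ht3L hE3 hnL hL11 hk20 htk => nullSide hθ hQt hQk' ht3L hE3 hnL hL11 hk20 htk

end Summit.PneNP.PneNP.Theorems.MonotoneSuffices.Room
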